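import Summits.NavierStokesRegularity.NavierStokesRegularity.Theorems.AdaptedFrequencyAdaptedKernelExistsKernelLimitExtract
import Summits.NavierStokesRegularity.NavierStokesRegularity.Theorems.AdaptedFrequencyAdaptedKernelExistsKernelLimitPairing
import Summits.NavierStokesRegularity.NavierStokesRegularity.Theorems.AdaptedFrequencyAdaptedKernelExistsKernelLimitSpace
import Literature.Analysis.FluidPDE.EnergyUniqueness
import HarnessLib

/-!
# Pointwise extraction along the adapted kernels of the blow-up sequence
# (route `AdaptedFrequency`, item `TangentFlowTransfer`, stmt-NavierStokesRegularity-10494)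

Helper file (all results proved). First step of the proof of hypothesis (B) (kernel
stability) of `tangentFlowTransfer_of_hyp`: along adapted kernels `g_k` of
`∂ₜ + w_k·∇ + Δ` on windows `[A_k, 0)`, `A_k → −∞`, with Type-I drifts `‖w_k‖ ≤ C₀/√(−t)` and
a common Gaussian upper bound, a subsequence converges at EVERY `(t, x)`, `t < 0`, and the limit
slices are continuous (`exists_pointwise_limit_of_adaptedKernels`).

The engine is the abstract extraction `kernelLimit_extract` of the `AdaptedKernelExists` line
(nash-entropy-last-block), fed by its uniform estimates, which depend on a kernel only through
a drift bound and a sup bound on an interior block — both uniform in `k` here: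
`kernelLimit_pairing_lipschitz` (equicontinuity in time of the pairings with test functions)
and `kernelLimit_space_modulus` (the interior spatial Lipschitz estimate for drift–heat
equations, `DriftHeatInteriorLipschitz`). The growing windows are absorbed by a fixed time
reparametrisation `θ(s) = s/(1+s) : (−1, 0) → (−∞, 0)` and by freezing each kernel below the
time `A_k/2` (`s ↦ g_k(max (θ s) (A_k/2))`), which keeps every slice a kernel slice.
-/

noncomputable section

open MeasureTheory Set Function Filter TopologicalSpace Metric
open scoped Topology ContDiff Laplacian

namespace Summit.NavierStokesRegularity.NavierStokesRegularity.Theorems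

open Literature.Analysis Literature.Analysis.FluidPDE
open Summit.NavierStokesRegularity.NavierStokesRegularity.Theorems.AdaptedKernelExists.NashEntropyLastBlock

local notation "ℝ³" => EuclideanSpace ℝ (Fin 3)

/-! ### Small tools -/

/-- Finitely many positive thresholds have a common positive lower threshold (for monotone
properties). [folklore] -/
theorem exists_pos_forall_lt_nat {Q : ℕ → ℝ → Prop} (h : ∀ j, ∃ δ : ℝ, 0 < δ ∧ Q j δ)
    (hmono : ∀ j δ δ', 0 < δ' → δ' ≤ δ → Q j δ → Q j δ') (n : ℕ) :
    ∃ δ : ℝ, 0 < δ ∧ ∀ j < n, Q j δ := by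
  induction n with
  | zero => exact ⟨1, one_pos, fun j hj => absurd hj (Nat.not_lt_zero j)⟩
  | succ n ih =>
    obtain ⟨δ₁, hδ₁, h₁⟩ := ih
    obtain ⟨δ₂, hδ₂, h₂⟩ := h n
    refine ⟨min δ₁ δ₂, lt_min hδ₁ hδ₂, fun j hj => ?_⟩
    rcases Nat.lt_succ_iff_lt_or_eq.1 hj with hj' | rfl
    · exact hmono j δ₁ _ (lt_min hδ₁ hδ₂) (min_le_left _ _) (h₁ j hj')
    · exact hmono _ δ₂ _ (lt_min hδ₁ hδ₂) (min_le_right _ _) h₂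

/-- The time reparametrisation `θ(s) = s/(1+s)` maps `(−1, 0)` into `(−∞, 0)`. [folklore] -/
theorem theta_neg {s : ℝ} (hs : s ∈ Ioo (-1 : ℝ) 0) : s / (1 + s) < 0 :=
  div_neg_of_neg_of_pos hs.2 (by linarith [hs.1])

/-- `θ(t/(1−t)) = t` for `t < 0`, with `t/(1−t) ∈ (−1, 0)`. [folklore] -/
theorem theta_section {t : ℝ} (ht : t < 0) :
    t / (1 - t) ∈ Ioo (-1 : ℝ) 0 ∧ (t / (1 - t)) / (1 + t / (1 - t)) = t := by
  have h1 : 0 < 1 - t := by linarith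
  refine ⟨⟨?_, div_neg_of_neg_of_pos ht h1⟩, ?_⟩
  · rw [lt_div_iff₀ h1]; linarith
  · have h2 : 1 + t / (1 - t) = 1 / (1 - t) := by field_simp; ring
    rw [h2]
    field_simp

/-- `θ` is monotone on `(−1, ∞)`. [folklore] -/
theorem theta_mono {s s' : ℝ} (hs : -1 < s) (hss' : s ≤ s') : s / (1 + s) ≤ s' / (1 + s') := by
  have h1 : 0 < 1 + s := by linarith
  have h2 : 0 < 1 + s' := by linarith
  rw [div_le_div_iff₀ h1 h2]
  nlinarith

/-- `θ` is Lipschitz on `[s₁, s₂] ⊂ (−1, ∞)` with constant `1/(1+s₁)²`. [folklore] -/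
theorem theta_lipschitz {s₁ s s' : ℝ} (hs₁ : -1 < s₁) (hs : s₁ ≤ s) (hs' : s₁ ≤ s') :
    |s' / (1 + s') - s / (1 + s)| ≤ (1 / (1 + s₁) ^ 2) * |s' - s| := by
  have h1 : 0 < 1 + s := by linarith
  have h2 : 0 < 1 + s' := by linarith
  have h0 : 0 < 1 + s₁ := by linarith
  have e : s' / (1 + s') - s / (1 + s) = (s' - s) / ((1 + s') * (1 + s)) := by
    field_simp; ring
  rw [e, abs_div, abs_of_pos (mul_pos h2 h1), div_eq_mul_inv, mul_comm]
  refine mul_le_mul_of_nonneg_right ?_ (abs_nonneg _)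
  rw [one_div, inv_le_inv₀ (mul_pos h2 h1) (pow_pos h0 2), sq]
  exact mul_le_mul (by linarith) (by linarith) h0.le h2.le

/-! ### The extraction -/

/-- **Pointwise extraction along the kernels of the blow-up sequence** (module docstring): a
subsequence of the adapted kernels converges at every `(t, x)` with `t < 0`, and every limit
slice is continuous. [folklore] -/
theorem exists_pointwise_limit_of_adaptedKernels {C₀ : ℝ} (hC₀ : 0 ≤ C₀) {A : ℕ → ℝ}
    (hA : Tendsto A atTop atBot) {w : ℕ → ℝ → ℝ³ → ℝ³}
    (hw : ∀ k, IsSmoothSpaceTimeOn (Ico (A k) 0) (w k))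
    (hdiv : ∀ k, ∀ t ∈ Ico (A k) 0, VectorCalculus.IsDivFree (w k t))
    (hI : ∀ k, ∀ t ∈ Ioo (A k) 0, ∀ x, ‖w k t x‖ ≤ C₀ / Real.sqrt (-t))
    {g : ℕ → ℝ → ℝ³ → ℝ} (hg : ∀ k, IsAdaptedBackwardKernel 1 (w k) (Ico (A k) 0) 0 0 (g k))
    {C₁ C₂ : ℝ} (hC₁ : 0 < C₁) (hC₂ : 0 < C₂)
    (hgb : ∀ k, ∀ t ∈ Ico (A k) 0, ∀ x, g k t x ≤ C₁ * ((0:ℝ) - t) ^ (-(3:ℝ) / 2) *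
      Real.exp (-(‖x - (0 : ℝ³)‖ ^ 2) / (C₂ * ((0:ℝ) - t)))) :
    ∃ φ : ℕ → ℕ, StrictMono φ ∧ ∃ Glim : ℝ → ℝ³ → ℝ,
      (∀ t < 0, ∀ x, Tendsto (fun j => g (φ j) t x) atTop (𝓝 (Glim t x))) ∧
      (∀ t < 0, ∀ x, ∀ ε : ℝ, 0 < ε → ∃ δ : ℝ, 0 < δ ∧
        ∀ᶠ j in atTop, ∀ y : ℝ³, ‖y - x‖ ≤ δ → |g (φ j) t y - g (φ j) t x| ≤ ε) := by
  -- shift so that `A_k ≤ -2`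
  obtain ⟨k₀, hk₀⟩ : ∃ k₀ : ℕ, ∀ k ≥ k₀, A k ≤ -2 :=
    eventually_atTop.1 (hA.eventually (eventually_le_atBot (-2)))
  set A' : ℕ → ℝ := fun j => A (j + k₀) with hA'
  have hA'2 : ∀ j, A' j ≤ -2 := fun j => hk₀ _ (Nat.le_add_left _ _)
  have hA't : Tendsto A' atTop atBot := hA.comp (tendsto_add_atTop_nat k₀)
  -- the frozen, reparametrised family on the fixed window `(-1, 0)`
  set m : ℕ → ℝ → ℝ := fun j s => max (s / (1 + s)) (A' j / 2) with hm
  have hmI : ∀ j, ∀ s ∈ Ioo (-1:ℝ) 0, m j s ∈ Ico (A' j) 0 := fun j s hs =>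
    ⟨le_trans (by linarith [hA'2 j]) (le_max_right _ _), max_lt (theta_neg hs) (by linarith [hA'2 j])⟩
  have hmI' : ∀ j, ∀ s ∈ Ioo (-1:ℝ) 0, m j s ∈ Ioo (A' j) 0 := fun j s hs =>
    ⟨lt_of_lt_of_le (by linarith [hA'2 j]) (le_max_right _ _), (hmI j s hs).2⟩
  have hmle : ∀ j s, m j s ≤ max (s / (1 + s)) (-1) := fun j s =>
    max_le_max le_rfl (by linarith [hA'2 j])
  set Gs : ℕ → ℝ → ℝ³ → ℝ := fun j s x => g (j + k₀) (m j s) x with hGs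
  have hgk : ∀ j, IsAdaptedBackwardKernel 1 (w (j + k₀)) (Ico (A' j) 0) 0 0 (g (j + k₀)) :=
    fun j => hg _
  -- Type-I drift bound below a negative time
  have hdrift : ∀ j, ∀ {r : ℝ}, r ∈ Ioo (A' j) 0 → ∀ {d : ℝ}, 0 < d → d ≤ -r → ∀ x,
      ‖w (j + k₀) r x‖ ≤ C₀ / Real.sqrt d := by
    intro j r hr d hd hdr x
    refine (hI _ r hr x).trans ?_
    exact div_le_div_of_nonneg_left hC₀ (Real.sqrt_pos.2 hd) (Real.sqrt_le_sqrt hdr)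
  -- Gaussian sup bound below a negative time
  have hsup : ∀ j, ∀ {r : ℝ}, r ∈ Ico (A' j) 0 → ∀ {d : ℝ}, 0 < d → d ≤ -r → ∀ x,
      |g (j + k₀) r x| ≤ C₁ * d ^ (-(3:ℝ) / 2) := by
    intro j r hr d hd hdr x
    rw [abs_of_pos ((hgk j).pos r hr x)]
    refine (hgb _ r hr x).trans ?_
    have h1 : ((0:ℝ) - r) ^ (-(3:ℝ) / 2) ≤ d ^ (-(3:ℝ) / 2) :=
      Real.rpow_le_rpow_of_nonpos hd (by linarith) (by norm_num)
    have h2 : Real.exp (-(‖x - (0 : ℝ³)‖ ^ 2) / (C₂ * ((0:ℝ) - r))) ≤ 1 := by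
      rw [Real.exp_le_one_iff, neg_div]
      exact neg_nonpos.2 (div_nonneg (sq_nonneg _) (mul_nonneg hC₂.le (by linarith [hr.2])))
    have h3 : 0 ≤ C₁ * ((0:ℝ) - r) ^ (-(3:ℝ) / 2) :=
      mul_nonneg hC₁.le (Real.rpow_nonneg (by linarith [hr.2]) _)
    calc C₁ * ((0:ℝ) - r) ^ (-(3:ℝ) / 2) * Real.exp (-(‖x - (0 : ℝ³)‖ ^ 2) / (C₂ * ((0:ℝ) - r)))
        ≤ C₁ * ((0:ℝ) - r) ^ (-(3:ℝ) / 2) * 1 := mul_le_mul_of_nonneg_left h2 h3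
      _ ≤ C₁ * d ^ (-(3:ℝ) / 2) := by rw [mul_one]; exact mul_le_mul_of_nonneg_left h1 hC₁.le
  -- (i) equicontinuity in time of the pairings
  have hequi_t : ∀ ψ : ℝ³ → ℝ, ContDiff ℝ ∞ ψ → HasCompactSupport ψ → ∀ s₁ s₂ : ℝ, (-1:ℝ) < s₁ →
      s₂ < 0 → ∃ L : ℝ, ∀ j, ∀ s ∈ Icc s₁ s₂, ∀ t ∈ Icc s₁ s₂,
        |(∫ x, ψ x * Gs j t x) - ∫ x, ψ x * Gs j s x| ≤ L * |t - s| := by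
    intro ψ hψ hψc s₁ s₂ hs₁ hs₂
    rcases lt_or_ge s₂ s₁ with h21 | h12
    · exact ⟨0, fun j s hs t ht => absurd (hs.1.trans hs.2) (not_le.2 h21)⟩
    -- bounds of the test function
    have hψ2 : ContDiff ℝ 2 ψ := contDiff_infty.1 hψ 2
    obtain ⟨M₁, hM₁⟩ := (hψc.fderiv (𝕜 := ℝ)).exists_bound_of_continuous
      (hψ2.continuous_fderiv two_ne_zero)
    obtain ⟨M₂', hM₂'⟩ := (hψc.iteratedFDeriv 2).exists_bound_of_continuous
      (hψ2.continuous_iteratedFDeriv le_rfl)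
    have hM₂ : ∀ x, |(Δ ψ) x| ≤ 3 * M₂' := by
      intro x
      have h1 := norm_laplacian_le ψ x
      rw [finrank_euclideanSpace_fin] at h1
      rw [← Real.norm_eq_abs]
      refine h1.trans ?_
      have h2 : ‖fderiv ℝ (fderiv ℝ ψ) x‖ = ‖iteratedFDeriv ℝ 2 ψ x‖ := by
        rw [← norm_iteratedFDeriv_fderiv, norm_iteratedFDeriv_one]
      rw [h2]; push_cast
      exact mul_le_mul_of_nonneg_left (hM₂' x) (by norm_num)
    -- the uniform drift bound on the relevant time range
    set d : ℝ := min (-(s₂ / (1 + s₂))) 1 with hd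
    have hθ2 : s₂ / (1 + s₂) < 0 := theta_neg ⟨by linarith, hs₂⟩
    have hd0 : 0 < d := lt_min (by linarith) one_pos
    set Bd : ℝ := C₀ / Real.sqrt d with hBd
    have hBd0 : 0 ≤ Bd := div_nonneg hC₀ (Real.sqrt_nonneg _)
    set Lθ : ℝ := 1 / (1 + s₁) ^ 2 with hLθ
    have hLθ0 : 0 ≤ Lθ := by rw [hLθ]; positivity
    refine ⟨(Bd * M₁ + 1 * (3 * M₂')) * Lθ, fun j s hs t ht => ?_⟩
    have hsI : s ∈ Ioo (-1:ℝ) 0 := ⟨by linarith [hs.1], by linarith [hs.2]⟩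
    have htI : t ∈ Ioo (-1:ℝ) 0 := ⟨by linarith [ht.1], by linarith [ht.2]⟩
    have hs₁I : s₁ ∈ Ioo (-1:ℝ) 0 := ⟨hs₁, by linarith [hs.1, hs.2]⟩
    have hs₂I : s₂ ∈ Ioo (-1:ℝ) 0 := ⟨by linarith, hs₂⟩
    -- monotonicity of the frozen clock
    have hmono : ∀ {a b : ℝ}, -1 < a → a ≤ b → m j a ≤ m j b := fun ha hab =>
      max_le_max (theta_mono ha hab) le_rfl
    have h₁ : A' j < m j s₁ := (hmI' j s₁ hs₁I).1
    have h₂ : m j s₂ < 0 := (hmI j s₂ hs₂I).2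
    have hbA : ∀ r ∈ Icc (m j s₁) (m j s₂), ∀ x ∈ tsupport ψ, ‖w (j + k₀) r x‖ ≤ Bd := by
      intro r hr x _
      have hrI : r ∈ Ioo (A' j) 0 := ⟨h₁.trans_le hr.1, hr.2.trans_lt h₂⟩
      refine hdrift j hrI hd0 ?_ x
      have := (hr.2.trans (hmle j s₂))
      -- `-r ≥ min (-(θ s₂)) 1`
      rcases le_total (s₂ / (1 + s₂)) (-1) with hc | hc
      · rw [max_eq_right hc] at this
        exact (min_le_right _ _).trans (by linarith)
      · rw [max_eq_left hc] at this
        exact (min_le_left _ _).trans (by linarith)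
    have key := kernelLimit_pairing_lipschitz (E := ℝ³) (ν := 1) zero_le_one (hw _) (hdiv _)
      (hgk j) hψ2 hψc h₁ h₂ hBd0 hbA hM₁ hM₂ (s := m j s) (t := m j t)
      ⟨hmono hs₁ hs.1, hmono hsI.1 hs.2⟩ ⟨hmono hs₁ ht.1, hmono htI.1 ht.2⟩
    refine key.trans ?_
    rw [mul_assoc]
    have hM₁0 : 0 ≤ M₁ := (norm_nonneg _).trans (hM₁ 0)
    have hM₂0 : 0 ≤ M₂' := (norm_nonneg _).trans (hM₂' 0)
    refine mul_le_mul_of_nonneg_left ?_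
      (add_nonneg (mul_nonneg hBd0 hM₁0) (mul_nonneg zero_le_one (by positivity)))
    calc |m j t - m j s| ≤ |t / (1 + t) - s / (1 + s)| := abs_max_sub_max_le_abs _ _ _
      _ ≤ Lθ * |t - s| := theta_lipschitz hs₁ hs.1 ht.1
  -- (ii) spatial equicontinuity at every `(s, x)`
  have hequi_x : ∀ s ∈ Ioo (-1:ℝ) 0, ∀ x : ℝ³, ∀ ε : ℝ, 0 < ε → ∃ δ : ℝ, 0 < δ ∧
      ∀ j (y : ℝ³), ‖y - x‖ ≤ δ → |Gs j s y - Gs j s x| ≤ ε := by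
    intro s hs x ε hε
    set t : ℝ := s / (1 + s) with htdef
    have ht : t < 0 := theta_neg hs
    -- the uniform modulus for the kernels whose window contains `[t, t/2]` strictly
    set τ : ℝ := -t / 2 with hτ
    have hτ0 : 0 < τ := by rw [hτ]; linarith
    set ρ : ℝ := Real.sqrt τ with hρ
    have hρ0 : 0 < ρ := Real.sqrt_pos.2 hτ0
    have hρτ : ρ ^ 2 ≤ 1 * τ := by rw [hρ, Real.sq_sqrt hτ0.le, one_mul]
    set Bd : ℝ := C₀ / Real.sqrt τ with hBd
    have hBd0 : 0 ≤ Bd := div_nonneg hC₀ (Real.sqrt_nonneg _)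
    set M : ℝ := C₁ * τ ^ (-(3:ℝ) / 2) + 1 with hM
    have hM0 : 0 < M := by
      have : 0 ≤ C₁ * τ ^ (-(3:ℝ) / 2) := mul_nonneg hC₁.le (Real.rpow_nonneg hτ0.le _)
      linarith
    set δu : ℝ := min (lipRad (Bd / 1) ρ)
      (ε / (lipConst (Bd / 1) ρ (Module.finrank ℝ ℝ³) * M + 1)) with hδu
    have hA1 : 0 ≤ Bd / 1 := by rw [div_one]; exact hBd0
    have hδu0 : 0 < δu := by
      refine lt_min (lipRad_pos hA1 hρ0) (div_pos hε ?_)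
      have := lipConst_pos hA1 hρ0 (Nat.cast_nonneg (Module.finrank ℝ ℝ³))
      positivity
    have hunif : ∀ j, A' j / 2 < t → ∀ y : ℝ³, ‖y - x‖ ≤ δu →
        |Gs j s y - Gs j s x| ≤ ε := by
      intro j hj y hy
      have hms : m j s = t := max_eq_left hj.le
      have e : ∀ z, Gs j s z = g (j + k₀) t z := fun z => by simp only [hGs, hms]
      rw [e, e]
      have htm : A' j < t := lt_trans (by linarith [hA'2 j]) hj
      have htT : t + τ < 0 := by rw [hτ]; linarith
      have hBd' : ∀ r ∈ Icc t (t + τ), ∀ z, ‖w (j + k₀) r z‖ ≤ Bd := by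
        intro r hr z
        exact hdrift j ⟨htm.trans_le hr.1, hr.2.trans_lt htT⟩ hτ0 (by rw [hτ]; linarith [hr.2]) z
      have hGM : ∀ r ∈ Icc t (t + τ), ∀ z, |g (j + k₀) r z| ≤ M := by
        intro r hr z
        have h := hsup j ⟨htm.le.trans hr.1, hr.2.trans_lt htT⟩ hτ0 (by rw [hτ]; linarith [hr.2]) z
        rw [hM]; linarith
      exact kernelLimit_space_modulus (E := ℝ³) one_pos htm hτ0 htT (hw _) hBd' hBd0 (hgk j) hM0
        hGM hρ0 hρτ hε x y hy
    -- the finitely many frozen kernels: continuity of each slice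
    obtain ⟨j₁, hj₁⟩ : ∃ j₁ : ℕ, ∀ j ≥ j₁, A' j / 2 < t := by
      obtain ⟨j₁, hj₁⟩ := eventually_atTop.1 (hA't.eventually (eventually_lt_atBot (2 * t)))
      exact ⟨j₁, fun j hj => by have := hj₁ j hj; linarith⟩
    have hfin : ∃ δ : ℝ, 0 < δ ∧ ∀ j < j₁, ∀ y : ℝ³, ‖y - x‖ ≤ δ →
        |Gs j s y - Gs j s x| ≤ ε := by
      refine exists_pos_forall_lt_nat (Q := fun j δ => ∀ y : ℝ³, ‖y - x‖ ≤ δ →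
        |Gs j s y - Gs j s x| ≤ ε) (fun j => ?_) (fun j δ δ' _ hδ h y hy => h y (hy.trans hδ)) j₁
      have hc : Continuous (Gs j s) := ((hgk j).contDiff_slice (hmI j s hs)).continuous
      obtain ⟨δ, hδ, h⟩ := Metric.continuousAt_iff.1 hc.continuousAt ε hε
      refine ⟨δ / 2, by positivity, fun y hy => ?_⟩
      have : dist y x < δ := by rw [dist_eq_norm]; linarith
      exact (le_of_lt (by simpa [Real.dist_eq] using h this))
    obtain ⟨δf, hδf, hfin'⟩ := hfin
    refine ⟨min δu δf, lt_min hδu0 hδf, fun j y hy => ?_⟩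
    rcases lt_or_ge j j₁ with hj | hj
    · exact hfin' j hj y (hy.trans (min_le_right _ _))
    · exact hunif j (hj₁ j hj) y (hy.trans (min_le_left _ _))
  -- the abstract extraction on the window `(-1, 0)`
  obtain ⟨φ, hφ, Glim, hlim⟩ := kernelLimit_extract (E := ℝ³) (tₘ := -1) (T := 0) (Gs := Gs)
    (fun j s hs => ((hgk j).contDiff_slice (hmI j s hs)).continuous)
    (fun j s hs x => ((hgk j).pos _ (hmI j s hs) x).le)
    (fun j s hs => (hgk j).integrable (hmI j s hs))
    (fun j s hs => ((hgk j).integral_eq_one _ (hmI j s hs)).le) hequi_t hequi_x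
  -- back to the original clock
  refine ⟨fun j => φ j + k₀, fun a b hab => Nat.add_lt_add_right (hφ hab) _,
    fun t x => Glim (t / (1 - t)) x, fun t ht x => ?_, fun t ht x ε hε => ?_⟩
  · obtain ⟨hsI, hθ⟩ := theta_section ht
    have hev : ∀ᶠ j in atTop, Gs (φ j) (t / (1 - t)) x = g (φ j + k₀) t x := by
      have h1 : ∀ᶠ j in atTop, A' (φ j) / 2 < t := by
        have := (hA't.comp hφ.tendsto_atTop).eventually (eventually_lt_atBot (2 * t))
        exact this.mono fun j hj => by have : A' (φ j) < 2 * t := hj; linarith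
      refine h1.mono fun j hj => ?_
      simp only [hGs, hm, hθ, max_eq_left hj.le]
    exact (hlim _ hsI x).congr' hev
  · obtain ⟨hsI, hθ⟩ := theta_section ht
    -- reuse the uniform spatial modulus at `(s, x)`, `s = t/(1-t)`: only the eventual part
    set s : ℝ := t / (1 - t) with hsdef
    set τ : ℝ := -t / 2 with hτ
    have hτ0 : 0 < τ := by rw [hτ]; linarith
    set ρ : ℝ := Real.sqrt τ with hρ
    have hρ0 : 0 < ρ := Real.sqrt_pos.2 hτ0
    have hρτ : ρ ^ 2 ≤ 1 * τ := by rw [hρ, Real.sq_sqrt hτ0.le, one_mul]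
    set Bd : ℝ := C₀ / Real.sqrt τ with hBd
    have hBd0 : 0 ≤ Bd := div_nonneg hC₀ (Real.sqrt_nonneg _)
    set M : ℝ := C₁ * τ ^ (-(3:ℝ) / 2) + 1 with hM
    have hM0 : 0 < M := by
      have : 0 ≤ C₁ * τ ^ (-(3:ℝ) / 2) := mul_nonneg hC₁.le (Real.rpow_nonneg hτ0.le _)
      linarith
    set δu : ℝ := min (lipRad (Bd / 1) ρ)
      (ε / (lipConst (Bd / 1) ρ (Module.finrank ℝ ℝ³) * M + 1)) with hδu
    have hA1 : 0 ≤ Bd / 1 := by rw [div_one]; exact hBd0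
    have hδu0 : 0 < δu := by
      refine lt_min (lipRad_pos hA1 hρ0) (div_pos hε ?_)
      have := lipConst_pos hA1 hρ0 (Nat.cast_nonneg (Module.finrank ℝ ℝ³))
      positivity
    refine ⟨δu, hδu0, ?_⟩
    have h1 : ∀ᶠ j in atTop, A' (φ j) / 2 < t := by
      have := (hA't.comp hφ.tendsto_atTop).eventually (eventually_lt_atBot (2 * t))
      exact this.mono fun j hj => by have : A' (φ j) < 2 * t := hj; linarith
    refine h1.mono fun j hj y hy => ?_
    have htm : A' (φ j) < t := lt_trans (by linarith [hA'2 (φ j)]) hj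
    have htT : t + τ < 0 := by rw [hτ]; linarith
    have hBd' : ∀ r ∈ Icc t (t + τ), ∀ z, ‖w (φ j + k₀) r z‖ ≤ Bd := by
      intro r hr z
      exact hdrift (φ j) ⟨htm.trans_le hr.1, hr.2.trans_lt htT⟩ hτ0 (by rw [hτ]; linarith [hr.2]) z
    have hGM : ∀ r ∈ Icc t (t + τ), ∀ z, |g (φ j + k₀) r z| ≤ M := by
      intro r hr z
      have h := hsup (φ j) ⟨htm.le.trans hr.1, hr.2.trans_lt htT⟩ hτ0 (by rw [hτ]; linarith [hr.2]) z
      rw [hM]; linarith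
    exact kernelLimit_space_modulus (E := ℝ³) one_pos htm hτ0 htT (hw _) hBd' hBd0 (hgk (φ j)) hM0
      hGM hρ0 hρτ hε x y hy

end Summit.NavierStokesRegularity.NavierStokesRegularity.Theorems

end
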